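import Literature.Probability.RandomPlanarGeometry.HexSAWSurfaceWallRenewalFourteenthCensusIdentity
import Literature.Probability.RandomPlanarGeometry.HexSAWSurfaceWallRenewalCensusFourteenA2
import Literature.Probability.RandomPlanarGeometry.HexSAWSurfaceWallRenewalCensusFourteenB6
import Literature.Probability.RandomPlanarGeometry.HexSAWSurfaceWallRenewalCensusFourteenC15
import Literature.Probability.RandomPlanarGeometry.HexSAWSurfaceWallRenewalCensusFourteenD18
import Literature.Probability.RandomPlanarGeometry.HexSAWSurfaceWallRenewalCensusFourteenE18
import Literature.Probability.RandomPlanarGeometry.HexSAWSurfaceWallRenewalCensusFourteenF4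
import HarnessLib

/-!
# The fourteenth-order coefficient of `β(y)²` is `−870`:
# `y¹³ (β(y)² − y − 1/y − 1/y² − 2/y³ − 4/y⁴ − 6/y⁵ − 12/y⁶ − 18/y⁷ − 15/y⁸ − 7/y⁹ + 16/y¹⁰ + 109/y¹¹ + 332/y¹²) → −870`

`β(y) = wallRate y` is the exponential growth rate of wall bridges of self-avoiding walks on the brick-wall (hexagonal) lattice along a zigzag wall with
contact fugacity `y`.  «FOURTEENTH-CENSUS-IDENTITY» identifies the fourteenth coefficient with `N₁₅,₁ + N₁₆,₂ + N₁₇,₃ + N₁₈,₄ + N₁₉,₅ + N₂₀,₆ + N₂₁,₇ − 215023`; this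
module substitutes `51018` («CENSUS-FOURTEEN-A»), `70726` («-B»), `55092` («-C»), `28622` («-D»), `8045` («-E»), `649` («-F») — the FAST counting engine, classes
C–F by the adaptive kernel certificate — and `N₂₁,₇ = 1` from the six-step rigidity (CAR 73, `card_filter_six_mul_visits_eq`: the hook `H₇`):

  ★★★ `tendsto_pow_thirteen_mul_wallRate_sq_sub : y¹³ (β(y)² − y − … + 109/y¹¹ + 332/y¹²) → −870` (`y → ∞`),

i.e. **`β(y)² = y + 1/y + 1/y² + 2/y³ + 4/y⁴ + 6/y⁵ + 12/y⁶ + 18/y⁷ + 15/y⁸ + 7/y⁹ − 16/y¹⁰ − 109/y¹¹ − 332/y¹² − 870/y¹³ + o(y⁻¹³)`**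
(`isLittleO_wallRate_sq_sub_fourteenth`, `eventually_fourteenth_order_window`, `tendsto_pow_thirteen_mul_wallRate_sq_sub_unique`, `fourteenth_coefficient_neg`).

HONEST LABEL.  LANE THEOREM, DERIVED (one-line assembly); NEW IN WRITING (modest).  Print: `β ∼ √y` ([BeatonBousquetMelouDeGierDuminilCopinGuttmann2014, §3.1, Proposition 5, p. 10]),
renewal structure ([MadrasSlade1993, §4.2], [Kesten1963SAW, §4]).  NOT CLAIMED: `a₁₄`, any rate, anything for `y ≤ μ³`.  No definitions.
-/

namespace Literature.Probability.RandomPlanarGeometry.SAW.HexBW.Wall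

open Finset Filter Function
open Literature.Probability.LatticeModels
open _root_.Topology Asymptotics

variable {y : ℝ}

/-- [folklore] Relabel the limit of a `Tendsto` by an equal constant. -/
private theorem tendsto_of_tendsto_of_eq_fx {f : ℝ → ℝ} {L c : ℝ} (h : Tendsto f atTop (𝓝 L)) (e : L = c) :
    Tendsto f atTop (𝓝 c) := e ▸ h

open Classical in
/-- `N₂₁,₇ = 1` at the numeral length: the seven-visit irreducible positive wall bridges of length `42` are the single hook `H₇` (six-step rigidity, CAR 73).
[cite: MadrasSlade1993, Section 4.2, remark before (4.2.21) (p. 94)] -/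
theorem card_sevenVisit_ipwb_fortytwo_eq {m : ℕ} (hm : m = 42) : #((ipwb m).filter fun ω => visits m ω = 7) = 1 := by
  have h := card_filter_six_mul_visits_eq (n := m) (by omega)
  rw [if_pos (show 6 ∣ m from ⟨7, by omega⟩)] at h
  rw [← h]
  refine congrArg Finset.card (Finset.filter_congr fun ω _ => ?_)
  omega

/-- ★★★ **THE FOURTEENTH-ORDER COEFFICIENT OF `β(y)²` IS `−870`:**
`y¹³ (β(y)² − y − … + 109/y¹¹ + 332/y¹²) → −870` as `y → ∞` — the census identity with `51018 + 70726 + 55092 + 28622 + 8045 + 649 + 1 = 214153` and `214153 − 215023 = −870`.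
[cite: BeatonBousquetMelouDeGierDuminilCopinGuttmann2014, Section 3.1, Proposition 5 (arXiv v5 p. 9); p. 10] [cite: Kesten1963SAW, Section 4] [cite: MadrasSlade1993, Section 4.2, (4.2.4), Theorem 4.2.2 (pp. 91–92)] -/
theorem tendsto_pow_thirteen_mul_wallRate_sq_sub :
    Tendsto (fun y : ℝ => y ^ 13 * (wallRate y ^ 2 - y - 1 / y - 1 / y ^ 2 - 2 / y ^ 3 - 4 / y ^ 4 - 6 / y ^ 5 - 12 / y ^ 6 - 18 / y ^ 7 - 15 / y ^ 8 -
      7 / y ^ 9 + 16 / y ^ 10 + 109 / y ^ 11 + 332 / y ^ 12)) atTop (𝓝 (-870)) := by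
  classical
  have h := tendsto_pow_thirteen_mul_wallRate_sq_sub_census (m₁ := 30) (m₂ := 32) (m₃ := 34) (m₄ := 36) (m₅ := 38) (m₆ := 40) (m₇ := 42) rfl rfl rfl rfl rfl rfl rfl
  rw [card_oneVisit_ipwb_thirty_eq rfl, card_twoVisit_ipwb_thirtytwo_eq rfl, card_threeVisit_ipwb_thirtyfour_eq rfl,
    card_fourVisit_ipwb_thirtysix_eq rfl, card_fiveVisit_ipwb_thirtyeight_eq rfl, card_sixVisit_ipwb_forty_eq rfl, card_sevenVisit_ipwb_fortytwo_eq rfl] at h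
  exact tendsto_of_tendsto_of_eq_fx h (by norm_num)

/-- ★★★ Landau form: `β(y)² − (y + 1/y + … − 109/y¹¹ − 332/y¹² − 870/y¹³) = o(y⁻¹³)` as `y → ∞`.
[cite: BeatonBousquetMelouDeGierDuminilCopinGuttmann2014, Section 3.1, Proposition 5 (arXiv v5 p. 9)] -/
theorem isLittleO_wallRate_sq_sub_fourteenth :
    (fun y : ℝ => wallRate y ^ 2 - (y + 1 / y + 1 / y ^ 2 + 2 / y ^ 3 + 4 / y ^ 4 + 6 / y ^ 5 + 12 / y ^ 6 + 18 / y ^ 7 + 15 / y ^ 8 + 7 / y ^ 9 - 16 / y ^ 10 - 109 / y ^ 11 - 332 / y ^ 12 - 870 / y ^ 13)) =o[atTop] fun y : ℝ => 1 / y ^ 13 := by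
  have h0 : Tendsto (fun y : ℝ => y ^ 13 * (wallRate y ^ 2 - y - 1 / y - 1 / y ^ 2 - 2 / y ^ 3 - 4 / y ^ 4 - 6 / y ^ 5 - 12 / y ^ 6 - 18 / y ^ 7 - 15 / y ^ 8 -
      7 / y ^ 9 + 16 / y ^ 10 + 109 / y ^ 11 + 332 / y ^ 12) - (-870)) atTop (𝓝 0) := by
    simpa using tendsto_pow_thirteen_mul_wallRate_sq_sub.sub_const (-870)
  have h1 : (fun y : ℝ => y ^ 13 * (wallRate y ^ 2 - y - 1 / y - 1 / y ^ 2 - 2 / y ^ 3 - 4 / y ^ 4 - 6 / y ^ 5 - 12 / y ^ 6 - 18 / y ^ 7 - 15 / y ^ 8 -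
      7 / y ^ 9 + 16 / y ^ 10 + 109 / y ^ 11 + 332 / y ^ 12) - (-870)) =o[atTop] fun _ : ℝ => (1 : ℝ) := (isLittleO_one_iff ℝ).2 h0
  have h2 := h1.mul_isBigO (isBigO_refl (fun y : ℝ => 1 / y ^ 13) atTop)
  refine (h2.congr' ?_ ?_)
  · filter_upwards [eventually_gt_atTop (0 : ℝ)] with y hy
    field_simp
    ring
  · exact Eventually.of_forall fun y => by simp

/-- ★★ Two-sided eventual form: for every `δ > 0`, eventually
`y + 1/y + … − 332/y¹² + (−870 − δ)/y¹³ ≤ β(y)² ≤ y + 1/y + … − 332/y¹² + (−870 + δ)/y¹³`.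
[cite: BeatonBousquetMelouDeGierDuminilCopinGuttmann2014, Section 3.1, Proposition 5 (arXiv v5 p. 9)] -/
theorem eventually_fourteenth_order_window {δ : ℝ} (hδ : 0 < δ) :
    ∀ᶠ y : ℝ in atTop, y + 1 / y + 1 / y ^ 2 + 2 / y ^ 3 + 4 / y ^ 4 + 6 / y ^ 5 + 12 / y ^ 6 + 18 / y ^ 7 + 15 / y ^ 8 + 7 / y ^ 9 - 16 / y ^ 10 - 109 / y ^ 11 - 332 / y ^ 12 +
        (-870 - δ) / y ^ 13 ≤ wallRate y ^ 2 ∧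
      wallRate y ^ 2 ≤ y + 1 / y + 1 / y ^ 2 + 2 / y ^ 3 + 4 / y ^ 4 + 6 / y ^ 5 + 12 / y ^ 6 + 18 / y ^ 7 + 15 / y ^ 8 + 7 / y ^ 9 - 16 / y ^ 10 - 109 / y ^ 11 - 332 / y ^ 12 +
        (-870 + δ) / y ^ 13 := by
  have h := tendsto_pow_thirteen_mul_wallRate_sq_sub
  have hlo := h.eventually (eventually_gt_nhds (show (-870 : ℝ) - δ < -870 by linarith))
  have hhi := h.eventually (eventually_lt_nhds (show (-870 : ℝ) < -870 + δ by linarith))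
  filter_upwards [hlo, hhi, eventually_gt_atTop (0 : ℝ)] with y h1 h2 hy
  have hy8 : 0 < y ^ 13 := pow_pos hy 13
  have e2 : wallRate y ^ 2 = (y + 1 / y + 1 / y ^ 2 + 2 / y ^ 3 + 4 / y ^ 4 + 6 / y ^ 5 + 12 / y ^ 6 + 18 / y ^ 7 + 15 / y ^ 8 + 7 / y ^ 9 - 16 / y ^ 10 - 109 / y ^ 11 - 332 / y ^ 12) +
      (y ^ 13 * (wallRate y ^ 2 - y - 1 / y - 1 / y ^ 2 - 2 / y ^ 3 - 4 / y ^ 4 - 6 / y ^ 5 - 12 / y ^ 6 - 18 / y ^ 7 - 15 / y ^ 8 -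
      7 / y ^ 9 + 16 / y ^ 10 + 109 / y ^ 11 + 332 / y ^ 12)) / y ^ 13 := by
    field_simp
    ring
  have elo : y + 1 / y + 1 / y ^ 2 + 2 / y ^ 3 + 4 / y ^ 4 + 6 / y ^ 5 + 12 / y ^ 6 + 18 / y ^ 7 + 15 / y ^ 8 + 7 / y ^ 9 - 16 / y ^ 10 - 109 / y ^ 11 - 332 / y ^ 12 + (-870 - δ) / y ^ 13 =
      (y + 1 / y + 1 / y ^ 2 + 2 / y ^ 3 + 4 / y ^ 4 + 6 / y ^ 5 + 12 / y ^ 6 + 18 / y ^ 7 + 15 / y ^ 8 + 7 / y ^ 9 - 16 / y ^ 10 - 109 / y ^ 11 - 332 / y ^ 12) + (-870 - δ) / y ^ 13 := by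
    ring
  have ehi : y + 1 / y + 1 / y ^ 2 + 2 / y ^ 3 + 4 / y ^ 4 + 6 / y ^ 5 + 12 / y ^ 6 + 18 / y ^ 7 + 15 / y ^ 8 + 7 / y ^ 9 - 16 / y ^ 10 - 109 / y ^ 11 - 332 / y ^ 12 + (-870 + δ) / y ^ 13 =
      (y + 1 / y + 1 / y ^ 2 + 2 / y ^ 3 + 4 / y ^ 4 + 6 / y ^ 5 + 12 / y ^ 6 + 18 / y ^ 7 + 15 / y ^ 8 + 7 / y ^ 9 - 16 / y ^ 10 - 109 / y ^ 11 - 332 / y ^ 12) + (-870 + δ) / y ^ 13 := by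
    ring
  rw [elo, ehi, e2]
  constructor
  · gcongr
  · gcongr

/-- ★ Uniqueness form: any limit of `y¹³ (β(y)² − y − … + 332/y¹²)` equals `−870`. [cite: MadrasSlade1993, Section 4.2, Theorem 4.2.2 (pp. 91–92)] -/
theorem tendsto_pow_thirteen_mul_wallRate_sq_sub_unique {L : ℝ}
    (h : Tendsto (fun y : ℝ => y ^ 13 * (wallRate y ^ 2 - y - 1 / y - 1 / y ^ 2 - 2 / y ^ 3 - 4 / y ^ 4 - 6 / y ^ 5 - 12 / y ^ 6 - 18 / y ^ 7 - 15 / y ^ 8 -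
      7 / y ^ 9 + 16 / y ^ 10 + 109 / y ^ 11 + 332 / y ^ 12)) atTop (𝓝 L)) :
    L = -870 :=
  tendsto_nhds_unique h tendsto_pow_thirteen_mul_wallRate_sq_sub

/-- ★★ **The fourteenth coefficient is negative too** (sequence `1, 1, 2, 4, 6, 12, 18, 15, 7, −16, −109, −332, −870`).
[cite: BeatonBousquetMelouDeGierDuminilCopinGuttmann2014, Section 3.1, Proposition 5 (arXiv v5 p. 9); p. 10] -/
theorem fourteenth_coefficient_neg {L : ℝ}
    (h : Tendsto (fun y : ℝ => y ^ 13 * (wallRate y ^ 2 - y - 1 / y - 1 / y ^ 2 - 2 / y ^ 3 - 4 / y ^ 4 - 6 / y ^ 5 - 12 / y ^ 6 - 18 / y ^ 7 - 15 / y ^ 8 -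
      7 / y ^ 9 + 16 / y ^ 10 + 109 / y ^ 11 + 332 / y ^ 12)) atTop (𝓝 L)) : L < 0 := by
  rw [tendsto_pow_thirteen_mul_wallRate_sq_sub_unique h]
  norm_num

end Literature.Probability.RandomPlanarGeometry.SAW.HexBW.Wall
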